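import Mathlib.MeasureTheory.Measure.Portmanteau
import Literature.Probability.RandomPlanarGeometry.HexSAW
import Literature.Probability.RandomPlanarGeometry.ConformalRestrictionProofs
import Literature.Probability.RandomPlanarGeometry.CritPercSLESimplePathHolds
import Literature.Probability.RandomPlanarGeometry.SimpleCurves
import Literature.Probability.RandomPlanarGeometry.WeaklySAW
import HarnessLib

/-!
# Crux `HexTransfer` (stmt-CriticalPhenomena-14221), line `yb-relay`: under DCS Conjecture 1 the
# critical hexagonal SAW does not creep along the boundary away from the marked points

Landing target: `Summits/CriticalPhenomena/SAWScalingLimit/Theorems/SAWDevelopingMapHexTransferNoBoundaryCreep.lean`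
(`--supports stmt-CriticalPhenomena-14221`; registered sub-goal `hex_noBoundaryCreep_of_hexSAWScalingLimit`).

This is the AWAY-FROM-THE-ENDPOINTS half of the line's research stub `stub_hexFaceRobust` (robustness of
DCS Conjecture 1 under the change of discretisation conventions; see the census
`Cruxes/HexTransfer/Lines/yb-relay-hexFaceRobust-census.md`, item 2): granted `HexSAWScalingLimit` (A),
for every `ρ > 0` and `ε > 0` there is a width `η > 0` such that, for all small meshes, the
probability that the critical hexagonal SAW of `(D_δ; a_δ, b_δ)` visits the `η`-neighbourhood of `∂D`
at distance `≥ ρ` from both marked points is `≤ ε`. Proof: the set `C_η` of curve classes whose trace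
meets the closed set `K_η = {z | infDist z ∂D ≤ η, dist z a ≥ ρ, dist z b ≥ ρ}` is closed in
`CurveClass ℂ` (its complement `{range ⊆ K_ηᶜ}` is open: compact traces have a positive margin,
`IsCompact.exists_cthickening_subset_open`, and `Curve.infDist_range_le`); by (A) and the portmanteau
theorem (`ProbabilityMeasure.limsup_measure_closed_le_of_tendsto`) `limsup P_δ(C_η) ≤ P(Γ ∈ C_η)` for
the SLE(8/3) limit `Γ`; `⋂ₙ C_{1/(n+1)} = C_0` (compactness of the trace), and `P(Γ ∈ C_0) = 0` because
chordal SLE(8/3) meets `∂D` only at the marked points (`IsSLELaw.ae_simple`, Rohde–Schramm Thm 6.1,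
discharged in the tree); continuity from above finishes.
-/

noncomputable section

namespace Summit.CriticalPhenomena.SAWScalingLimit.Cruxes.HexTransfer.YbRelay

open MeasureTheory Filter Topology Set Metric
open scoped NNReal ENNReal BoundedContinuousFunction
open Literature.Probability.RandomPlanarGeometry
open Literature.Probability.RandomPlanarGeometry.SAW
open Literature.Probability.LatticeModels (HexVertex hexGraph hexCenter)
open Literature.Probability (Process.preWienerMeasure)

/-! ### Curve classes whose trace stays inside an open set form an open set -/

/-- If the (compact) trace of a curve class lies in an open set `U`, so do the traces of all nearby
curve classes. [folklore] -/
theorem isOpen_rangeSubset_of_isOpen {U : Set ℂ} (hU : IsOpen U) :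
    IsOpen (CurveClass.rangeSubset U) := by
  rw [Metric.isOpen_iff]
  intro c hc
  obtain ⟨γ, rfl⟩ := CurveClass.surjective_mk c
  rw [CurveClass.mk_mem_rangeSubset] at hc
  obtain ⟨r, hr, hsub⟩ := (CurveClass.isCompact_range (CurveClass.mk γ)).exists_cthickening_subset_open hU
    (by rw [CurveClass.range_mk]; rintro _ ⟨t, rfl⟩; exact hc t)
  refine ⟨r, hr, fun c' hc' => ?_⟩
  obtain ⟨γ', rfl⟩ := CurveClass.surjective_mk c'
  rw [CurveClass.mk_mem_rangeSubset]
  intro t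
  apply hsub
  rw [CurveClass.range_mk]
  have h1 : Metric.infDist (γ' t) γ.range ≤ dist γ' γ := Curve.infDist_range_le γ' γ t
  have h2 : dist γ' γ < r := by
    rw [← CurveClass.dist_mk_mk]; exact Metric.mem_ball.1 hc'
  obtain ⟨y, hy, hdy⟩ :=
    (Metric.infDist_lt_iff (CurveClass.range_nonempty (CurveClass.mk γ))).1 (h1.trans_lt h2)
  exact Metric.mem_cthickening_of_dist_le _ y _ _ hy hdy.le

/-- Curve classes whose trace MEETS a closed set form a closed set. [folklore] -/
theorem isClosed_setOf_range_inter_nonempty {K : Set ℂ} (hK : IsClosed K) :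
    IsClosed {c : CurveClass ℂ | (c.range ∩ K).Nonempty} := by
  have : {c : CurveClass ℂ | (c.range ∩ K).Nonempty} = (CurveClass.rangeSubset Kᶜ)ᶜ := by
    ext c
    simp only [mem_setOf_eq, mem_compl_iff, CurveClass.mem_rangeSubset, subset_compl_iff_disjoint_right,
      not_disjoint_iff_nonempty_inter]
  rw [this]
  exact (isOpen_rangeSubset_of_isOpen hK.isOpen_compl).isClosed_compl

/-! ### The boundary layer away from the marked points -/

/-- The closed layer `K_η = {z | infDist z ∂D ≤ η, ρ ≤ dist z a, ρ ≤ dist z b}`. [folklore] -/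
theorem isClosed_layer (D : DobrushinDomain) (ρ η : ℝ) :
    IsClosed {z : ℂ | infDist z (frontier D.carrier) ≤ η ∧ ρ ≤ dist z (D.pt 0) ∧ ρ ≤ dist z (D.pt 1)} :=
  (isClosed_le (continuous_infDist_pt _) continuous_const).inter
    ((isClosed_le continuous_const (continuous_id.dist continuous_const)).inter
      (isClosed_le continuous_const (continuous_id.dist continuous_const)))

/-- **No boundary creep under DCS Conjecture 1** (registered sub-goal of line `yb-relay`, crux
stmt-CriticalPhenomena-14221; the away-from-the-endpoints half of `stub_hexFaceRobust`): granted
`HexSAWScalingLimit`, for every Dobrushin domain, hexagonal endpoint approximation, `ρ > 0` and `ε > 0`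
there is `η > 0` such that for all small `δ` the critical hexagonal SAW law gives mass `≤ ε` to the walks
whose drawn curve comes within `η` of `∂D` at distance `≥ ρ` from both marked points. [folklore] -/
theorem hex_noBoundaryCreep_of_hexSAWScalingLimit : HexSAWScalingLimit → ∀ (D : DobrushinDomain) (a b : ℝ → HexVertex), IsEmbEndpointApprox hexGraph hexCenter D a b → ∀ ρ : ℝ, 0 < ρ → ∀ ε : ℝ, 0 < ε → ∃ η : ℝ, 0 < η ∧ ∀ᶠ δ in 𝓝[>] (0 : ℝ), hexSAWLaw D.carrier δ (a δ) (b δ) {γ | ∃ z ∈ (γ.curve).range, infDist z (frontier D.carrier) ≤ η ∧ ρ ≤ dist z (D.pt 0) ∧ ρ ≤ dist z (D.pt 1)} ≤ ENNReal.ofReal ε := by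
  classical
  intro hA D a b hab ρ hρ ε hε
  haveI := isProbabilityMeasure_preWienerMeasure'
  obtain ⟨Γ, hΓ, -, hT⟩ := hA D a b hab
  -- the layers and the closed sets of curve classes meeting them
  let K : ℝ → Set ℂ := fun η =>
    {z : ℂ | infDist z (frontier D.carrier) ≤ η ∧ ρ ≤ dist z (D.pt 0) ∧ ρ ≤ dist z (D.pt 1)}
  let C : ℝ → Set (CurveClass ℂ) := fun η => {c | (c.range ∩ K η).Nonempty}
  have hCcl : ∀ η, IsClosed (C η) := fun η => isClosed_setOf_range_inter_nonempty (isClosed_layer D ρ η)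
  have hCmeas : ∀ η, MeasurableSet (C η) := fun η => (hCcl η).measurableSet
  have hCmono : Antitone fun n : ℕ => C (1 / ((n : ℝ) + 1)) := by
    intro m n hmn c hc
    obtain ⟨z, hz, hz1, hz2⟩ := hc
    refine ⟨z, hz, hz1.trans ?_, hz2⟩
    exact one_div_le_one_div_of_le (by positivity) (by exact_mod_cast Nat.succ_le_succ hmn)
  -- the SLE law charges no curve meeting `∂D` away from the marked points
  let μ : Measure (CurveClass ℂ) := Process.preWienerMeasure.map Γ
  haveI hμ : IsProbabilityMeasure μ := Measure.isProbabilityMeasure_map hΓ.aemeasurable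
  have hμ0 : μ (⋂ n : ℕ, C (1 / ((n : ℝ) + 1))) = 0 := by
    have hs := IsSLELaw.ae_simple ae_isSimpleTrace_sleTrace_of_le_four_holds
      CurveClass.measurableSet_simple_holds (by positivity)
      (by rw [div_le_iff₀ (by norm_num : (0 : ℝ≥0) < 3)]; norm_num) hΓ.isSLELaw_map
    refine measure_mono_null (fun c hc => ?_) (ae_iff.1 hs)
    simp only [mem_setOf_eq]
    intro hgood
    rw [mem_iInter] at hc
    -- points `z n ∈ range ∩ K (1/(n+1))`; a cluster point `w` lies on `∂D`, far from both marks
    choose z hz using fun n => hc n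
    obtain ⟨w, hw, φ, hφ, hwφ⟩ := (CurveClass.isCompact_range c).tendsto_subseq fun n => (hz n).1
    have hlim : Tendsto (fun n : ℕ => 1 / ((φ n : ℝ) + 1)) atTop (𝓝 0) := by
      have h0 : Tendsto (fun n : ℕ => 1 / ((n : ℝ) + 1)) atTop (𝓝 0) :=
        tendsto_one_div_add_atTop_nhds_zero_nat
      exact h0.comp hφ.tendsto_atTop
    have hw1 : infDist w (frontier D.carrier) ≤ 0 :=
      le_of_tendsto_of_tendsto ((continuous_infDist_pt _).continuousAt.tendsto.comp hwφ) hlim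
        (Eventually.of_forall fun n => (hz (φ n)).2.1)
    have hwfr : w ∈ frontier D.carrier := by
      have h0 : infDist w (frontier D.carrier) = 0 := le_antisymm hw1 infDist_nonneg
      have hne : (frontier D.carrier).Nonempty := ⟨D.pt 0, D.pt_mem_frontier 0⟩
      exact (isClosed_frontier.mem_iff_infDist_zero hne).2 h0
    have hwa : ρ ≤ dist w (D.pt 0) :=
      ge_of_tendsto ((continuous_id.dist continuous_const).continuousAt.tendsto.comp hwφ)
        (Eventually.of_forall fun n => (hz (φ n)).2.2.1)
    have hwb : ρ ≤ dist w (D.pt 1) :=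
      ge_of_tendsto ((continuous_id.dist continuous_const).continuousAt.tendsto.comp hwφ)
        (Eventually.of_forall fun n => (hz (φ n)).2.2.2)
    have hmem := hgood.2 ⟨hw, hwfr⟩
    simp only [mem_insert_iff, mem_singleton_iff] at hmem
    rcases hmem with rfl | rfl
    · simp at hwa; linarith
    · simp at hwb; linarith
  -- continuity from above: some layer has SLE-mass `< ε`
  have hμlim : Tendsto (fun n : ℕ => μ (C (1 / ((n : ℝ) + 1)))) atTop (𝓝 0) := by
    have h := tendsto_measure_iInter_atTop (μ := μ) (fun n => (hCmeas _).nullMeasurableSet) hCmono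
      ⟨0, measure_ne_top μ _⟩
    rwa [hμ0] at h
  obtain ⟨N, hN⟩ := (ENNReal.tendsto_atTop_zero.1 hμlim) (ENNReal.ofReal (ε / 2))
    (ENNReal.ofReal_pos.2 (half_pos hε))
  have hNle : μ (C (1 / ((N : ℝ) + 1))) ≤ ENNReal.ofReal (ε / 2) := hN N le_rfl
  refine ⟨1 / ((N : ℝ) + 1), by positivity, ?_⟩
  -- package the hexagonal laws as probability measures on `CurveClass ℂ` (junk off the good set)
  let Pδ : ∀ δ : ℝ, Measure (HexDomainSAW D.carrier δ (a δ) (b δ)) := fun δ =>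
    hexSAWLaw D.carrier δ (a δ) (b δ)
  have hP : ∀ δ, Pδ δ = 0 ∨ IsProbabilityMeasure (Pδ δ) := fun δ =>
    Literature.Probability.RandomPlanarGeometry.WeaklySAW.normalize_dichotomy _
  have hev : ∀ᶠ δ in 𝓝[>] (0 : ℝ), IsProbabilityMeasure (Pδ δ) := by
    have h1 := hT (BoundedContinuousFunction.const (CurveClass ℂ) 1)
    simp only [BoundedContinuousFunction.const_apply, integral_const, smul_eq_mul, mul_one,
      probReal_univ] at h1
    filter_upwards [h1.eventually (lt_mem_nhds one_half_lt_one)] with δ hδ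
    rcases hP δ with h0 | hp
    · simp only [Pδ] at h0
      rw [h0] at hδ
      norm_num at hδ
    · exact hp
  let ν : ProbabilityMeasure (CurveClass ℂ) := ⟨μ, hμ⟩
  let νs : ℝ → ProbabilityMeasure (CurveClass ℂ) := fun δ =>
    if hδ : IsProbabilityMeasure (Pδ δ) then
      ⟨(Pδ δ).map (fun γ => γ.curve),
        Measure.isProbabilityMeasure_map (EmbDomainSAW.measurable_of_top _).aemeasurable⟩
    else ν
  have hT' : Tendsto νs (𝓝[>] 0) (𝓝 ν) := by
    rw [ProbabilityMeasure.tendsto_iff_forall_integral_tendsto]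
    intro f
    have h1 := hT f
    have e2 : ∫ x, f x ∂(ν : Measure (CurveClass ℂ)) = ∫ ω, f (Γ ω) ∂Process.preWienerMeasure :=
      integral_map hΓ.aemeasurable f.continuous.aestronglyMeasurable
    rw [e2]
    refine h1.congr' ?_
    filter_upwards [hev] with δ hδ
    simp only [νs, dif_pos hδ, ProbabilityMeasure.coe_mk]
    exact (integral_map (EmbDomainSAW.measurable_of_top _).aemeasurable
      f.continuous.aestronglyMeasurable).symm
  have hlimsup := ProbabilityMeasure.limsup_measure_closed_le_of_tendsto hT' (hCcl (1 / ((N : ℝ) + 1)))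
  have hlt : limsup (fun δ => (νs δ : Measure (CurveClass ℂ)) (C (1 / ((N : ℝ) + 1)))) (𝓝[>] 0) <
      ENNReal.ofReal ε :=
    lt_of_le_of_lt (hlimsup.trans hNle) ((ENNReal.ofReal_lt_ofReal_iff hε).2 (by linarith))
  filter_upwards [hev, Filter.eventually_lt_of_limsup_lt hlt] with δ hδ h2
  have key : hexSAWLaw D.carrier δ (a δ) (b δ) {γ | ∃ z ∈ (γ.curve).range,
      infDist z (frontier D.carrier) ≤ 1 / ((N : ℝ) + 1) ∧ ρ ≤ dist z (D.pt 0) ∧ ρ ≤ dist z (D.pt 1)} =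
      (νs δ : Measure (CurveClass ℂ)) (C (1 / ((N : ℝ) + 1))) := by
    simp only [νs, dif_pos hδ, ProbabilityMeasure.coe_mk]
    rw [Measure.map_apply (EmbDomainSAW.measurable_of_top _) (hCmeas _)]
    rfl
  rw [key]
  exact h2.le

end Summit.CriticalPhenomena.SAWScalingLimit.Cruxes.HexTransfer.YbRelay

end
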